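import Summits.NavierStokesRegularity.NavierStokesRegularity.Theorems.SelfMixingDichotomyCoherentScaleExclusionMixMaxPrinciple
import Literature.Analysis.FluidPDE.SchefferTestFunction
import Literature.Analysis.FluidPDE.RapidDecayLemmas
import HarnessLib

/-!
# Crux `SelfMixingDichotomy.CoherentScaleExclusion` (stmt-NavierStokesRegularity-1423),
# line `registered`: stub TAIL `stub_heatBlob_gaussian_upper` — Gaussian tail of the heat
# evolution of a blob

Support file (`--supports stmt-NavierStokesRegularity-1423`) of the line lead c3. "Admissible"
scalars on a window `[a, b]` are jointly `C^∞` on the closed slab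
(`IsSmoothSpaceTimeOn (Icc a b) θ`), have uniform rapid decay of all within-slab derivatives
(`HasUniformRapidDecayOn (Icc a b) θ`) and solve the heat equation `∂ₜθ = Δθ` with the one-sided
time derivative `timeDerivWithin (Icc a b)`. If the datum satisfies `θ(a, ·) ≤ 1` and is
supported in the ball `B(0, r)`, then on the whole slab

  `θ(t, x) ≤ e^{1/4} · exp (-‖x‖² / (4 (t - a + r²)))`.

Proof: comparison with the exact Gaussian solution `g(t, x) = K · G_{s(t)}(x)`,
`s(t) = t - a + r²`, `G_σ = heatKernel σ` the Gauss–Weierstrass kernel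
`(4πσ)^{-n/2} e^{-‖x‖²/(4σ)}` and `K = e^{1/4} (4πr²)^{n/2}`, i.e.
`g(t, x) = e^{1/4} (r²/s)^{n/2} e^{-‖x‖²/(4s)}`.
(1) `g(a, x) = e^{1/4 - ‖x‖²/(4r²)} ≥ 1 ≥ θ(a, x)` for `‖x‖ < r`, and `θ(a, x) = 0 ≤ g(a, x)`
for `‖x‖ ≥ r`. (2) `g` is a classical solution of the heat equation on the slab:
`∂_σ G_σ = ΔG_σ` (`hasDerivAt_heatKernel_time`, `Scheffer.laplacian_heatKernel`, both equal to
`(‖x‖²/(4σ²) - n/(2σ)) G_σ`). (3) The bounded-class weak maximum principle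
`mixMaxPrinciple_le_of_datum_le` (Friedman 1964, Ch. 2 §4 Thm. 10, via the tree's
`nonpos_of_linear_parabolic`) with zero drift applied to `w = θ - g` gives `θ ≤ g`, and
`g(t, x) ≤ e^{1/4} e^{-‖x‖²/(4s)}` because `(4πs)^{-n/2} ≤ (4πr²)^{-n/2}` for `s ≥ r²`.
-/

noncomputable section

open Set Function Filter Metric
open _root_.Topology
open scoped Laplacian Real

-- `Summit = Problem` for this summit; the tree lakefile sets `weak.linter.dupNamespace = false`.
set_option linter.dupNamespace false

namespace Summit.NavierStokesRegularity.NavierStokesRegularity.Theorems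

open Literature.Analysis.FluidPDE
open Literature.Analysis.UnboundedOperators (heatKernel heatKernel_pos hasDerivAt_heatKernel_time
  contDiffOn_uncurry_heatKernel)

section Gaussian

variable {E : Type*} [NormedAddCommGroup E] [InnerProductSpace ℝ E]

/-- The peak factor of the Gauss–Weierstrass kernel at time `r²`: there is `P > 0`
(`P = (4πr²)^{-n/2}`) with `G_{r²}(x) = P e^{-‖x‖²/(4r²)}` and, for `σ ≥ r²`,
`G_σ(x) ≤ P e^{-‖x‖²/(4σ)}` (the prefactor `(4πσ)^{-n/2}` is antitone in `σ`). -/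
theorem heatGaussianTail_exists_peak {r : ℝ} (hr : 0 < r) :
    ∃ P : ℝ, 0 < P ∧
      (∀ x : E, heatKernel (r ^ 2) x = P * Real.exp (-‖x‖ ^ 2 / (4 * r ^ 2))) ∧
      ∀ σ : ℝ, r ^ 2 ≤ σ → ∀ x : E, heatKernel σ x ≤ P * Real.exp (-‖x‖ ^ 2 / (4 * σ)) := by
  refine ⟨(4 * π * r ^ 2) ^ (-(Module.finrank ℝ E : ℝ) / 2),
    Real.rpow_pos_of_pos (by positivity) _, fun x => rfl, fun σ hσ x => ?_⟩
  unfold heatKernel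
  refine mul_le_mul_of_nonneg_right ?_ (Real.exp_pos _).le
  have hn : (0 : ℝ) ≤ Module.finrank ℝ E := Nat.cast_nonneg _
  exact Real.rpow_le_rpow_of_nonpos (by positivity)
    (mul_le_mul_of_nonneg_left hσ (by positivity)) (by linarith)

/-- Joint continuity of the time-shifted Gaussian `(τ, y) ↦ K · G_{τ - a + r²}(y)` on the slab
`[a, b] × E` (there `τ - a + r² ≥ r² > 0`, where the kernel is jointly smooth,
`contDiffOn_uncurry_heatKernel`). -/
theorem heatGaussianTail_continuousOn_gaussian (K a b : ℝ) {r : ℝ} (hr : 0 < r) :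
    ContinuousOn (uncurry fun (τ : ℝ) (y : E) => K * heatKernel (τ - a + r ^ 2) y)
      (Icc a b ×ˢ univ) := by
  have hmap : Continuous (fun q : ℝ × E => ((q.1 - a + r ^ 2, q.2) : ℝ × E)) := by fun_prop
  have hmaps : MapsTo (fun q : ℝ × E => ((q.1 - a + r ^ 2, q.2) : ℝ × E)) (Icc a b ×ˢ univ)
      (Ioi 0 ×ˢ univ) := by
    intro q hq
    refine ⟨?_, mem_univ _⟩
    have h1 : q.1 ∈ Icc a b := (mem_prod.1 hq).1
    have h2 : 0 < r ^ 2 := by positivity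
    simp only [mem_Ioi]
    linarith [h1.1]
  have h := ((contDiffOn_uncurry_heatKernel (E := E) (m := 0)).continuousOn).comp
    hmap.continuousOn hmaps
  exact continuousOn_const.mul h

variable [FiniteDimensional ℝ E]

/-- The time-shifted Gaussian `g(τ, y) = K · G_{τ - a + r²}(y)` solves the heat equation
classically wherever `τ - a + r² > 0`: `∂_τ g(t, x) = Δ(g(t, ·))(x)`, from
`∂_σ G_σ = (‖x‖²/(4σ²) - n/(2σ)) G_σ = ΔG_σ` (`hasDerivAt_heatKernel_time`,
`Scheffer.laplacian_heatKernel`). -/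
theorem heatGaussianTail_hasDerivAt_gaussian (K a r : ℝ) {t : ℝ} (hσ : 0 < t - a + r ^ 2)
    (x : E) :
    HasDerivAt (fun τ => K * heatKernel (τ - a + r ^ 2) x)
      ((Δ (fun y : E => K * heatKernel (t - a + r ^ 2) y)) x) t := by
  have h1 := hasDerivAt_heatKernel_time hσ x
  have h2 : HasDerivAt (fun τ : ℝ => τ - a + r ^ 2) 1 t := by
    simpa using ((hasDerivAt_id t).sub_const a).add_const (r ^ 2)
  have h3 : HasDerivAt (fun τ => heatKernel (τ - a + r ^ 2) x)
      (((‖x‖ ^ 2 / (4 * (t - a + r ^ 2) ^ 2) -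
        (Module.finrank ℝ E : ℝ) / (2 * (t - a + r ^ 2))) * heatKernel (t - a + r ^ 2) x) * 1)
      t := by
    have hc := h1.comp t h2
    exact hc
  refine (h3.const_mul K).congr_deriv ?_
  rw [mul_one, show (fun y : E => K * heatKernel (t - a + r ^ 2) y) =
      K • heatKernel (E := E) (t - a + r ^ 2) from rfl,
    InnerProductSpace.laplacian_smul K ((Scheffer.contDiff_heatKernel _).contDiffAt),
    Scheffer.laplacian_heatKernel, smul_eq_mul]

end Gaussian

/-- **TAIL — Gaussian tail of the heat evolution of a blob** (registered sub-goal
`stub_heatBlob_gaussian_upper` of the crux `CoherentScaleExclusion`, line `registered`, lead c3).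
A jointly smooth, uniformly rapidly decaying solution of `∂ₜθ = Δθ` on `[a, b] × ℝ³` (one-sided
time derivative within `Icc a b`) with datum `θ(a, ·) ≤ 1` supported in `B(0, r)` satisfies
`θ(t, x) ≤ e^{1/4} exp (-‖x‖²/(4(t - a + r²)))` on the slab: comparison (bounded-class weak
maximum principle `mixMaxPrinciple_le_of_datum_le`, zero drift) with the exact Gaussian solution
`e^{1/4} (4πr²)^{3/2} G_{t - a + r²}`, which dominates the datum and is dominated by the claimed
tail. -/
theorem stub_heatBlob_gaussian_upper :
    ∀ (a b : ℝ), a < b → ∀ (θ : ℝ → EuclideanSpace ℝ (Fin 3) → ℝ) (r : ℝ), 0 < r →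
      IsSmoothSpaceTimeOn (Set.Icc a b) θ → HasUniformRapidDecayOn (Set.Icc a b) θ →
      (∀ t ∈ Set.Icc a b, ∀ x : EuclideanSpace ℝ (Fin 3),
        timeDerivWithin (Set.Icc a b) θ t x = Laplacian.laplacian (θ t) x) →
      (∀ x : EuclideanSpace ℝ (Fin 3), θ a x ≤ 1) →
      Function.support (θ a) ⊆ Metric.ball (0 : EuclideanSpace ℝ (Fin 3)) r →
      ∀ t ∈ Set.Icc a b, ∀ x : EuclideanSpace ℝ (Fin 3),
        θ t x ≤ Real.exp (1 / 4) * Real.exp (-‖x‖ ^ 2 / (4 * (t - a + r ^ 2))) := by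
  intro a b hab θ r hr hs hd he h1 hsupp
  -- the peak factor `P = (4πr²)^{-3/2}` and the comparison Gaussian `g = e^{1/4} P⁻¹ G_{t-a+r²}`
  obtain ⟨P, hP0, hPeq, hPle⟩ := heatGaussianTail_exists_peak (E := EuclideanSpace ℝ (Fin 3)) hr
  set K : ℝ := Real.exp (1 / 4) * P⁻¹ with hK
  have hK0 : 0 < K := by rw [hK]; positivity
  set g : ℝ → EuclideanSpace ℝ (Fin 3) → ℝ := fun t x => K * heatKernel (t - a + r ^ 2) x
    with hg
  have hσ : ∀ t ∈ Icc a b, 0 < t - a + r ^ 2 := fun t ht => by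
    have : 0 < r ^ 2 := by positivity
    linarith [ht.1]
  have hσ' : ∀ t ∈ Icc a b, r ^ 2 ≤ t - a + r ^ 2 := fun t ht => by linarith [ht.1]
  -- `0 ≤ g ≤ e^{1/4} e^{-‖x‖²/(4s)} ≤ e^{1/4}` on the slab
  have hgnn : ∀ t ∈ Icc a b, ∀ x, 0 ≤ g t x := fun t ht x =>
    mul_nonneg hK0.le (heatKernel_pos (hσ t ht) x).le
  have hgle : ∀ t ∈ Icc a b, ∀ x, g t x ≤
      Real.exp (1 / 4) * Real.exp (-‖x‖ ^ 2 / (4 * (t - a + r ^ 2))) := fun t ht x => by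
    have h := hPle _ (hσ' t ht) x
    calc g t x = K * heatKernel (t - a + r ^ 2) x := rfl
      _ ≤ K * (P * Real.exp (-‖x‖ ^ 2 / (4 * (t - a + r ^ 2)))) :=
          mul_le_mul_of_nonneg_left h hK0.le
      _ = Real.exp (1 / 4) * Real.exp (-‖x‖ ^ 2 / (4 * (t - a + r ^ 2))) := by
          rw [hK]; field_simp
  have hgbd : ∀ t ∈ Icc a b, ∀ x, g t x ≤ Real.exp (1 / 4) := fun t ht x => by
    refine (hgle t ht x).trans (mul_le_of_le_one_right (Real.exp_pos _).le ?_)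
    rw [Real.exp_le_one_iff, neg_div]
    have : 0 ≤ ‖x‖ ^ 2 / (4 * (t - a + r ^ 2)) :=
      div_nonneg (by positivity) (by linarith [hσ t ht])
    linarith
  -- the difference `w = θ - g` and the zero drift
  set w : ℝ → EuclideanSpace ℝ (Fin 3) → ℝ := fun t x => θ t x - g t x with hw
  set β : ℝ → EuclideanSpace ℝ (Fin 3) → EuclideanSpace ℝ (Fin 3) := fun _ _ => 0 with hβdef
  have hβ : ∀ t ∈ Icc a b, ∀ x : EuclideanSpace ℝ (Fin 3), ‖β t x‖ ≤ 0 := fun _ _ _ => by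
    simp [hβdef]
  -- continuity on the closed slab
  have hc : ContinuousOn (uncurry w) (Icc a b ×ˢ univ) :=
    hs.continuousOn.sub (heatGaussianTail_continuousOn_gaussian K a b hr)
  -- `C²` slices
  have h2θ : ∀ t ∈ Icc a b, ContDiff ℝ 2 (θ t) := fun t ht =>
    (hs.contDiff_slice ht).of_le (by norm_cast)
  have h2g : ∀ t, ContDiff ℝ 2 (g t) := fun t =>
    contDiff_const.mul (Scheffer.contDiff_heatKernel _)
  have h2 : ∀ t ∈ Ioc a b, ContDiff ℝ 2 (w t) := fun t ht =>
    (h2θ t (Ioc_subset_Icc_self ht)).sub (h2g t)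
  -- the equation for the left time derivative on `(a, b]`
  have ht : ∀ t ∈ Ioc a b, ∀ x, HasDerivWithinAt (fun τ => w τ x)
      ((Δ (w t)) x + fderiv ℝ (w t) x (β t x)) (Iic t) t := by
    intro t htI x
    have htc : t ∈ Icc a b := Ioc_subset_Icc_self htI
    have heq₁ : derivWithin (fun s => θ s x) (Icc a b) t = (Δ (θ t)) x := he t htc x
    have h₁ : HasDerivWithinAt (fun s => θ s x) ((Δ (θ t)) x) (Icc a b) t :=
      heq₁ ▸ (hs.differentiableWithinAt_time htc x).hasDerivWithinAt
    have h₂ : HasDerivWithinAt (fun s => g s x) ((Δ (g t)) x) (Icc a b) t :=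
      (heatGaussianTail_hasDerivAt_gaussian K a r (hσ t htc) x).hasDerivWithinAt
    have h := (h₁.sub h₂).mono_of_mem_nhdsWithin (Icc_mem_nhdsLE_of_mem htI)
    refine h.congr_deriv ?_
    have hc1 : ContDiffAt ℝ 2 (θ t) x := (h2θ t htc).contDiffAt
    have hc2 : ContDiffAt ℝ 2 (g t) x := (h2g t).contDiffAt
    rw [show w t = θ t - g t from rfl, hc1.laplacian_sub hc2]
    simp [hβdef]
  -- boundedness: `|θ| ≤ C` from the order-zero decay bound, `0 ≤ g ≤ e^{1/4}`
  obtain ⟨C, -, hC⟩ := hd.norm_le_rpow 0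
  have hbd : ∀ t ∈ Icc a b, ∀ x, |w t x| ≤ C + Real.exp (1 / 4) := fun t ht' x => by
    have hθ := hC t ht' x
    simp only [Nat.cast_zero, neg_zero, Real.rpow_zero, mul_one, Real.norm_eq_abs] at hθ
    have hga := hgnn t ht' x
    have hgb := hgbd t ht' x
    simp only [hw]
    rw [abs_le]
    constructor <;> linarith [(abs_le.1 hθ).1, (abs_le.1 hθ).2]
  -- the datum: `θ(a, ·) ≤ g(a, ·)`
  have h0 : ∀ x, w a x ≤ 0 := fun x => by
    simp only [hw]
    by_cases hx : x ∈ ball (0 : EuclideanSpace ℝ (Fin 3)) r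
    · -- inside the ball: `θ ≤ 1 ≤ e^{1/4 - ‖x‖²/(4r²)} = g`
      have hxr : ‖x‖ < r := mem_ball_zero_iff.1 hx
      have hx4 : ‖x‖ ^ 2 / (4 * r ^ 2) ≤ 1 / 4 := by
        rw [div_le_div_iff₀ (by positivity) (by norm_num)]
        nlinarith [norm_nonneg x]
      have hga : 1 ≤ g a x := by
        have hgax : g a x = Real.exp (1 / 4 + -‖x‖ ^ 2 / (4 * r ^ 2)) := by
          simp only [hg]
          rw [show a - a + r ^ 2 = r ^ 2 by ring, hPeq x, hK, Real.exp_add]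
          field_simp
        rw [hgax]
        exact Real.one_le_exp (by rw [neg_div]; linarith)
      linarith [h1 x]
    · -- outside the ball the datum vanishes
      have hθ0 : θ a x = 0 := notMem_support.1 fun h => hx (hsupp h)
      linarith [hgnn a (left_mem_Icc.2 hab.le) x]
  -- the maximum principle, then `g ≤ e^{1/4} e^{-‖x‖²/(4s)}`
  have hz := mixMaxPrinciple_le_of_datum_le hβ hc h2 ht hbd h0
  intro t htI x
  have hle := hz t htI x
  simp only [hw] at hle
  exact (sub_nonpos.1 hle).trans (hgle t htI x)

end Summit.NavierStokesRegularity.NavierStokesRegularity.Theorems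

end
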